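import Summits.QuantumFields.BalabanUV.Beta.GAN24.TopLagrangeKSlotLip
import Summits.QuantumFields.BalabanUV.Beta.GAN24.TopLagrangeKSlotAt

/-!
# `BalabanUV.Beta.GAN24.TopLagrangeKSlotLipAt` — binder row G-an2-4 / (CONV-C), S-slot, rows S3-Lt ∕ R3-dLt AT THE IN-BLOCK ROOT `r`: the rooted trilinear functional
# `lamTopKerAt (toSite r) Lc` is bi-localised and Lipschitz in its three slots (twin of leaf-04 g19's `TopLagrangeKSlotLip` §3; the displayed constants
# `kerConst` ∕ `lipKerConst` and `comp_sub_comp_bd` are root-free and used BY NAME — the rooted middle slot has the SAME `midConst`)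

NOT IN PRINT; OUR PROOF ATTEMPT.  HONEST FRAMING (cell contract, verbatim): «discharging `BetaPertH` makes Bałaban's UV stability UNCONDITIONAL — a real
constructive-QFT result; it is NOT the continuum limit and NOT the Clay problem.»  HONEST DEPENDENCY (verbatim): «continuum YM on T⁴ ⇐ BetaPertH ∧ nine spine
estimates (0/9 proved); BetaPertH ⇐ (D1) ∧ (D4) ∧ CAP+tail; G-an2-4 gates asym, D1 and NE2/3/4.»  [folklore] bookkeeping: the base proofs VERBATIM over
`TopLagrangeKSlotAt.{biLoc_lamTopMid, lamTopMid_sub}` (this lineage) and the root-free `TopLagrangeKSlotLip.{kerConst, kerConst_nonneg, comp_sub_comp_bd, lipKerConst}`,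
an2∕an5∕asym1's kernel calculus BY NAME; same theorem names in this namespace; 0 `def`, 0 cite, 0 `def … : Prop`, 0 sorry; nothing of the base module is edited.
Discharges NOTHING of (hS, hSall) ∕ hBdev; part of «ROOTED-S3-Λ-DIFF» (row `S3DiffLtAt` ahead); NEVER «G-an2-4 closed»; NOT (CONV-C) as typed, NOT D1, NOT BetaPertH,
NOT continuum, NOT Clay.  `b2b-balaban-gan24-formalise-leaf-06` gen 41.
-/

noncomputable section

open Finset
open scoped BigOperators
open Literature.MathematicalPhysics.QuantumFieldTheory
open Literature.MathematicalPhysics.QuantumFieldTheory.Balaban1983to89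
open Literature.MathematicalPhysics.QuantumFieldTheory.Balaban1983to89.Beta
open B12Sec2to5 (l1 l1_nonneg)
open ExpKernelCalculus (MKer Decays BiLoc comp Zl Zl_nonneg biLoc_comp_decays)
open OneStepResolventKernel (Fib LocStencil decays_mono)
open AffineAveraging (box toSite)
open AveragingHessianKernels (ell)
open BalabanStepJetsSucc (mmRead biLoc_mmRead biLoc_comp_right)
open KernelWard (Bdd bdd_of_decays biLoc_add slices_biLoc_bdd comp_sub_left comp_sub_right)
open HessKerRate (biLoc_comp_sub_comp)
open Summit.QuantumFields.BalabanUV.Beta.GAN24.ThirdJetKernel (mmRead_sub)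
open Summit.QuantumFields.BalabanUV.Beta.GAN24.TopLagrangeKSlot (midConst midConst_nonneg)
open Summit.QuantumFields.BalabanUV.Beta.GAN24.TopLagrangeKSlotLip (kerConst kerConst_nonneg comp_sub_comp_bd lipKerConst)
open Summit.QuantumFields.BalabanUV.Beta.GAN24.TopLagrangeKSlotAt (lamTopMidAt lamTopKerAt biLoc_lamTopMid lamTopMid_sub)

namespace Summit.QuantumFields.BalabanUV.Beta.GAN24.TopLagrangeKSlotLipAt

variable {d : ℕ}

/-! ## §3 Bounds: the trilinear functional is bi-localised, and Lipschitz in its three slots -/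

section Bounds

variable {Lc : ℕ} [NeZero Lc] {r : Fin (d + 1) → ℕ}

/-- [folklore] **THE TRILINEAR FUNCTIONAL IS A LOCAL STENCIL ENTRY**: three slots decaying at rate `δ` ⇒ `lamTopKerAt (toSite r) Lc K₁ K₂ K₃ κ′ u′` is bi-localised at
`(u′, u′)` on the coarse lattice, constant `kerConst`, rate `δ/8` (`biLoc_lamTopMid` → `biLoc_comp_decays` → `biLoc_comp_right` → `biLoc_mmRead`; the rate is
quartered as in an2's `locStencil_e3Of`). -/
theorem biLoc_lamTopKer (hLc : 1 ≤ Lc) (hr : r ∈ box (d + 1) Lc) {K₁ K₂ K₃ : MKer (d + 1) (Fib d)} {C₁ C₂ C₃ δ : ℝ} (h₁ : Decays K₁ C₁ δ) (h₂ : Decays K₂ C₂ δ)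
    (h₃ : Decays K₃ C₃ δ) (hδ : 0 < δ) (κ' : Fin (d + 1)) (u' : Fin (d + 1) → ℤ) :
    BiLoc (lamTopKerAt (toSite r) Lc K₁ K₂ K₃ κ' u') u' u' (kerConst d Lc C₁ C₂ C₃ δ) (δ / 8) := by
  have hC₁ : 0 ≤ C₁ := h₁.nonneg (Sum.inl 0)
  have hC₃ : 0 ≤ C₃ := h₃.nonneg (Sum.inl 0)
  have hV := biLoc_lamTopMid hLc hr h₂ hδ κ' u'
  have h₁' : Decays K₁ C₁ (δ / 2) := decays_mono h₁ hC₁ le_rfl (by linarith)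
  have hc1 := biLoc_comp_decays h₁' hV (show 0 ≤ δ / 4 by linarith) (by linarith)
  have h₃' : Decays K₃ C₃ (δ / 4) := decays_mono h₃ hC₃ le_rfl (by linarith)
  have hc2 := biLoc_comp_right hc1 h₃' (show 0 ≤ δ / 8 by linarith) (by linarith)
  have hm := biLoc_mmRead hLc hc2 (show 0 ≤ δ / 8 by linarith)
  intro x' z' a b
  rw [show lamTopKerAt (toSite r) Lc K₁ K₂ K₃ κ' u' x' z' a b = -(mmRead Lc (comp (comp K₁ (lamTopMidAt (toSite r) Lc K₂ κ' u')) K₃) x' z' a b) from rfl,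
    abs_neg]
  exact hm x' z' a b

/-- [folklore] Hence: all three slots `K` ⇒ `lamTopKerAt (toSite r) Lc K K K` is a LOCAL STENCIL FAMILY (an2's `LocStencil`) on the coarse lattice. -/
theorem locStencil_lamTopKer (hLc : 1 ≤ Lc) (hr : r ∈ box (d + 1) Lc) {K : MKer (d + 1) (Fib d)} {C δ : ℝ} (hK : Decays K C δ) (hδ : 0 < δ) :
    LocStencil (lamTopKerAt (toSite r) Lc K K K) (kerConst d Lc C C C δ) (δ / 8) :=
  fun κ' u' => biLoc_lamTopKer hLc hr hK hK hK hδ κ' u'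

/-- [folklore] **THE TRILINEAR FUNCTIONAL IS LIPSCHITZ IN ITS THREE SLOTS**: slots decaying at rate `δ` with constants `C₁, C₂, C₃` (unprimed) and
`C₁′, C₂′, C₃′` (primed), DEVIATIONS `Decays (Kᵢ′ − Kᵢ) εᵢ δ` ⇒ `lamTopKerAt (toSite r) Lc K₁′ K₂′ K₃′ κ′ u′ − lamTopKerAt (toSite r) Lc K₁ K₂ K₃ κ′ u′` is bi-localised at `(u′, u′)`
with constant `lipKerConst C₁ C₂ C₂′ C₃′ δ ε₁ ε₂ ε₃` (each term carries exactly one `εᵢ`), rate `δ/8`.  Mechanism: `mmRead_sub`; `comp_sub_comp_bd` for the outer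
right slot; `HessKerRate.biLoc_comp_sub_comp` for `K₁′∘V′ − K₁∘V` with `V′ − V = lamTopMidAt (toSite r) Lc (K₂′ − K₂)` (`lamTopMid_sub`, `biLoc_lamTopMid`). -/
theorem biLoc_lamTopKer_sub (hLc : 1 ≤ Lc) (hr : r ∈ box (d + 1) Lc) {K₁ K₂ K₃ K₁' K₂' K₃' : MKer (d + 1) (Fib d)}
    {C₁ C₂ C₃ C₁' C₂' C₃' ε₁ ε₂ ε₃ δ : ℝ}
    (h₁ : Decays K₁ C₁ δ) (h₂ : Decays K₂ C₂ δ) (h₃ : Decays K₃ C₃ δ)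
    (h₁' : Decays K₁' C₁' δ) (h₂' : Decays K₂' C₂' δ) (h₃' : Decays K₃' C₃' δ)
    (hd₁ : Decays (K₁' - K₁) ε₁ δ) (hd₂ : Decays (K₂' - K₂) ε₂ δ) (hd₃ : Decays (K₃' - K₃) ε₃ δ) (hδ : 0 < δ)
    (κ' : Fin (d + 1)) (u' : Fin (d + 1) → ℤ) :
    BiLoc (lamTopKerAt (toSite r) Lc K₁' K₂' K₃' κ' u' - lamTopKerAt (toSite r) Lc K₁ K₂ K₃ κ' u') u' u'
      (lipKerConst d Lc C₁ C₂ C₂' C₃' δ ε₁ ε₂ ε₃) (δ / 8) := by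
  have hC₁ : 0 ≤ C₁ := h₁.nonneg (Sum.inl 0)
  have hC₁' : 0 ≤ C₁' := h₁'.nonneg (Sum.inl 0)
  have hC₃ : 0 ≤ C₃ := h₃.nonneg (Sum.inl 0)
  have hC₃' : 0 ≤ C₃' := h₃'.nonneg (Sum.inl 0)
  have hε₁ : 0 ≤ ε₁ := hd₁.nonneg (Sum.inl 0)
  have hε₃ : 0 ≤ ε₃ := hd₃.nonneg (Sum.inl 0)
  -- the middle slots and their difference (rate δ/2, at the dilated bond)
  have hV := biLoc_lamTopMid hLc hr h₂ hδ κ' u'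
  have hV' := biLoc_lamTopMid hLc hr h₂' hδ κ' u'
  have hVV : BiLoc (lamTopMidAt (toSite r) Lc K₂' κ' u' - lamTopMidAt (toSite r) Lc K₂ κ' u') ((Lc : ℤ) • u') ((Lc : ℤ) • u')
      (midConst d Lc ε₂ δ) (δ / 2) := by
    rw [lamTopMid_sub hLc hr h₂ h₂' hδ]
    exact biLoc_lamTopMid hLc hr hd₂ hδ κ' u'
  -- the left slots at rate δ/2
  have g₁ : Decays K₁ C₁ (δ / 2) := decays_mono h₁ hC₁ le_rfl (by linarith)
  have g₁' : Decays K₁' C₁' (δ / 2) := decays_mono h₁' hC₁' le_rfl (by linarith)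
  have gd₁ : Decays (K₁' - K₁) ε₁ (δ / 2) := decays_mono hd₁ hε₁ le_rfl (by linarith)
  -- inner difference `K₁′∘V′ − K₁∘V`, rate δ/4
  have hin := biLoc_comp_sub_comp g₁' g₁ gd₁ hV' hV hVV (half_pos hδ)
  -- the two inner compositions themselves, rate δ/4
  have hc1 := biLoc_comp_decays g₁ hV (show 0 ≤ δ / 4 by linarith) (by linarith)
  have hc1' := biLoc_comp_decays g₁' hV' (show 0 ≤ δ / 4 by linarith) (by linarith)
  -- the right slots at rate δ/4
  have g₃ : Decays K₃ C₃ (δ / 4) := decays_mono h₃ hC₃ le_rfl (by linarith)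
  have g₃' : Decays K₃' C₃' (δ / 4) := decays_mono h₃' hC₃' le_rfl (by linarith)
  have gd₃ : Decays (K₃' - K₃) ε₃ (δ / 4) := decays_mono hd₃ hε₃ le_rfl (by linarith)
  -- telescoping of the outer right slot
  have hin' : BiLoc (comp K₁' (lamTopMidAt (toSite r) Lc K₂' κ' u') - comp K₁ (lamTopMidAt (toSite r) Lc K₂ κ' u')) ((Lc : ℤ) • u') ((Lc : ℤ) • u')
      ((Fintype.card (Fib d) : ℝ) * (ε₁ * midConst d Lc C₂' δ) * Zl (d + 1) (δ / 2 - δ / 2 / 2) +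
        (Fintype.card (Fib d) : ℝ) * (C₁ * midConst d Lc ε₂ δ) * Zl (d + 1) (δ / 2 - δ / 2 / 2)) (δ / 4) := by
    have e : δ / 2 / 2 = δ / 4 := by ring
    rw [← e]
    exact hin
  have htel := comp_sub_comp_bd hc1' hc1 g₃' g₃ (show 0 < δ / 4 by linarith)
  have hA := biLoc_comp_right hin' g₃' (show 0 ≤ δ / 8 by linarith) (by linarith)
  have hB := biLoc_comp_right hc1 gd₃ (show 0 ≤ δ / 8 by linarith) (by linarith)
  have hsum := biLoc_add hA hB
  rw [← htel] at hsum
  have hm := biLoc_mmRead hLc hsum (show 0 ≤ δ / 8 by linarith)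
  intro x' z' a b
  have e : (lamTopKerAt (toSite r) Lc K₁' K₂' K₃' κ' u' - lamTopKerAt (toSite r) Lc K₁ K₂ K₃ κ' u') x' z' a b =
      -(mmRead Lc (comp (comp K₁' (lamTopMidAt (toSite r) Lc K₂' κ' u')) K₃' - comp (comp K₁ (lamTopMidAt (toSite r) Lc K₂ κ' u')) K₃) x' z' a b) := by
    rw [mmRead_sub]
    simp only [lamTopKerAt, Pi.sub_apply]
    ring
  rw [e, abs_neg]
  exact (hm x' z' a b).trans (le_of_eq (by simp only [lipKerConst]))

end Bounds

end Summit.QuantumFields.BalabanUV.Beta.GAN24.TopLagrangeKSlotLipAt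

end
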